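import Summits.ValiantsHypothesis.ValiantsHypothesis.Theorems.LangWeilTransferTameResolutionDetWeight
import Summits.ValiantsHypothesis.ValiantsHypothesis.Theorems.LangWeilTransferTameResolutionFactorWeightPrelims

/-!
# LangWeilTransfer, support item `TameResolution` (stmt-ValiantsHypothesis-6378) — sizes of the
# Sylvester matrix, the resultant with the derivative and the Bézout cofactors

Route `LangWeilTransfer` of `ValiantsHypothesis` (conditional route; honest framing: bookkeeping,
nothing here bears on VP ≠ VNP). Quantitative pass (roadmap note of val-lit-p6 g9, §1(B)): for
`q ∈ ℤ[X_κ][U]` with coefficients of weight `≤ W` and total degree `≤ D`, and `U`-degree `≤ N`,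

* `weight_sylvester_le`, `totalDegree_sylvester_le` — entries of `Syl(f, g)`;
* `weight_coeff_derivative_le`, `totalDegree_coeff_derivative_le` — coefficients of `q'`;
* `weight_resultant_le`, `totalDegree_resultant_le` — `wt(Res_{m,n}(f, g)) ≤ (m+n)! W^{m+n}`,
  `deg ≤ (m+n) D`;
* `weight_adjugate_sylvester_le`, `totalDegree_adjugate_sylvester_le` — the same for the adjugate
  entries, i.e. (by `exists_bezout_explicit`) for the coefficients of the Bézout cofactors.
-/

noncomputable section

open Polynomial
open Literature.Computability.AlgebraicComplexity

-- the summit and the problem share the name `ValiantsHypothesis` (D-0017 single-conjunct layout)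
set_option linter.dupNamespace false

namespace Summit.ValiantsHypothesis.ValiantsHypothesis.Theorems.LangWeilTransfer

variable {κ : Type*} {m n : ℕ}

/-- Entries of the Sylvester matrix are coefficients of `f`, of `g`, or `0`: weight bound. -/
theorem weight_sylvester_le (f g : Polynomial (MvPolynomial κ ℤ)) {W : ℕ}
    (hf : ∀ k, weight (f.coeff k) ≤ W) (hg : ∀ k, weight (g.coeff k) ≤ W) (i j : Fin (m + n)) :
    weight (sylvester f g m n i j) ≤ W := by
  induction j using Fin.addCases with
  | left j => simp only [sylvester, Matrix.of_apply, Fin.addCases_left]; split_ifs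
              · exact hg _
              · rw [weight_zero]; exact Nat.zero_le _
  | right j => simp only [sylvester, Matrix.of_apply, Fin.addCases_right]; split_ifs
               · exact hf _
               · rw [weight_zero]; exact Nat.zero_le _

/-- Entries of the Sylvester matrix: total degree bound. -/
theorem totalDegree_sylvester_le {R : Type*} [CommRing R] (f g : Polynomial (MvPolynomial κ R)) {D : ℕ}
    (hf : ∀ k, (f.coeff k).totalDegree ≤ D) (hg : ∀ k, (g.coeff k).totalDegree ≤ D) (i j : Fin (m + n)) :
    (sylvester f g m n i j).totalDegree ≤ D := by
  induction j using Fin.addCases with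
  | left j => simp only [sylvester, Matrix.of_apply, Fin.addCases_left]; split_ifs
              · exact hg _
              · rw [MvPolynomial.totalDegree_zero]; exact Nat.zero_le _
  | right j => simp only [sylvester, Matrix.of_apply, Fin.addCases_right]; split_ifs
               · exact hf _
               · rw [MvPolynomial.totalDegree_zero]; exact Nat.zero_le _

/-- Coefficients of the derivative: `wt ≤ N · W` if `deg_U q ≤ N`. -/
theorem weight_coeff_derivative_le (q : Polynomial (MvPolynomial κ ℤ)) {W N : ℕ}
    (hq : ∀ k, weight (q.coeff k) ≤ W) (hN : q.natDegree ≤ N) (k : ℕ) :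
    weight ((derivative q).coeff k) ≤ N * W := by
  rw [coeff_derivative]
  by_cases hk : k + 1 ≤ q.natDegree
  · have hcast : ((k : MvPolynomial κ ℤ) + 1) = MvPolynomial.C (((k + 1 : ℕ) : ℤ)) := by
      rw [map_natCast]; push_cast; rfl
    rw [hcast, mul_comm, weight_C_mul, Int.natAbs_natCast]
    exact Nat.mul_le_mul (hk.trans hN) (hq _)
  · push Not at hk
    rw [coeff_eq_zero_of_natDegree_lt hk, zero_mul, weight_zero]
    exact Nat.zero_le _

/-- Coefficients of the derivative: total degree bound. -/
theorem totalDegree_coeff_derivative_le {R : Type*} [CommRing R] (q : Polynomial (MvPolynomial κ R)) {D : ℕ}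
    (hq : ∀ k, (q.coeff k).totalDegree ≤ D) (k : ℕ) :
    ((derivative q).coeff k).totalDegree ≤ D := by
  rw [coeff_derivative]
  refine (MvPolynomial.totalDegree_mul _ _).trans ?_
  have : ((k : MvPolynomial κ R) + 1).totalDegree = 0 := by
    rw [show ((k : MvPolynomial κ R) + 1) = MvPolynomial.C ((k : R) + 1) by
      rw [map_add, map_natCast, map_one], MvPolynomial.totalDegree_C]
  rw [this, add_zero]
  exact hq _

/-- **Weight of a resultant.** -/
theorem weight_resultant_le (f g : Polynomial (MvPolynomial κ ℤ)) {W : ℕ}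
    (hf : ∀ k, weight (f.coeff k) ≤ W) (hg : ∀ k, weight (g.coeff k) ≤ W) :
    weight (resultant f g m n) ≤ (m + n).factorial * W ^ (m + n) := by
  classical
  have h := weight_det_le (sylvester f g m n) (fun i j => weight_sylvester_le f g hf hg i j)
  rw [Polynomial.resultant]
  simpa only [Fintype.card_fin] using h

/-- **Total degree of a resultant.** -/
theorem totalDegree_resultant_le {R : Type*} [CommRing R] (f g : Polynomial (MvPolynomial κ R)) {D : ℕ}
    (hf : ∀ k, (f.coeff k).totalDegree ≤ D) (hg : ∀ k, (g.coeff k).totalDegree ≤ D) :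
    (resultant f g m n).totalDegree ≤ (m + n) * D := by
  classical
  have h := totalDegree_det_le (sylvester f g m n) (fun i j => totalDegree_sylvester_le f g hf hg i j)
  rw [Polynomial.resultant]
  simpa only [Fintype.card_fin] using h

/-- **Weight of the adjugate entries of the Sylvester matrix** (the coefficients of the Bézout
cofactors, `exists_bezout_explicit`). -/
theorem weight_adjugate_sylvester_le (f g : Polynomial (MvPolynomial κ ℤ)) {W : ℕ} (hW : 1 ≤ W)
    (hf : ∀ k, weight (f.coeff k) ≤ W) (hg : ∀ k, weight (g.coeff k) ≤ W) (i j : Fin (m + n)) :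
    weight ((sylvester f g m n).adjugate i j) ≤ (m + n).factorial * W ^ (m + n) := by
  classical
  have h := weight_adjugate_le (sylvester f g m n) hW (fun i j => weight_sylvester_le f g hf hg i j) i j
  simpa only [Fintype.card_fin] using h

/-- **Total degree of the adjugate entries of the Sylvester matrix.** -/
theorem totalDegree_adjugate_sylvester_le {R : Type*} [CommRing R] (f g : Polynomial (MvPolynomial κ R))
    {D : ℕ} (hf : ∀ k, (f.coeff k).totalDegree ≤ D) (hg : ∀ k, (g.coeff k).totalDegree ≤ D)
    (i j : Fin (m + n)) :
    ((sylvester f g m n).adjugate i j).totalDegree ≤ (m + n) * D := by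
  classical
  have h := totalDegree_adjugate_le (sylvester f g m n) (fun i j => totalDegree_sylvester_le f g hf hg i j) i j
  simpa only [Fintype.card_fin] using h

end Summit.ValiantsHypothesis.ValiantsHypothesis.Theorems.LangWeilTransfer
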